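import Summits.NavierStokesRegularity.NavierStokesRegularity.Theorems.ExtremiserTransienceNearExtremalTransienceSharpForm
import HarnessLib

/-!
# Route `ExtremiserTransience`, crux `NearExtremalTransience` (stmt-NavierStokesRegularity-21883):
# THE CRUX WITHOUT THE ADDITIVE CONSTANT — eventual domination of the log-time mean

`--supports stmt-NavierStokesRegularity-21883`. Author: prover seat `ns-et-p1` (g2), on `…SharpForm`.

`nearExtremalTransience_iff_sharp_eventually`: the crux holds iff there is ONE `θ ∈ [0,1)` such that along every
Type-I singular classical Leray–Hopf rapidly-decaying-datum flow on `[0,T)` every minimal measurable flow-wise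
coefficient `k₀` (the stretching efficiency `R(t)`) satisfies, EVENTUALLY as `t ↑ T`,
`∫_0^t k₀²/(T−τ) dτ ≤ (θκ⋆)²·log(T/(T−t))` — no onset, no additive constant, no choice of coefficient or constant
(`κ⋆ = sInf` of the universal depletion constants, spelled out). (`→`: from the sharp onset-zero form with `θ`, the
constant `B` is absorbed by `((1+θ)/2·κ⋆)² − (θκ⋆)² > 0` times `log(T/(T−t)) → ∞`,
`tendsto_log_div_sub_atTop`; `←`: before the eventual time the integral is bounded by its value there, since the
integrand is nonnegative.) Negation, for refuters: the crux FAILS iff for every `θ < 1` some Type-I singular flow has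
`∫_0^t R²/(T−τ) > (θκ⋆)² log(T/(T−t))` for times `t` arbitrarily close to `T`.

WHAT THIS IS NOT: no `θ < 1` is proved; the crux, the route and the summit stay open; Navier–Stokes regularity is
NOT proved. [folklore]
-/

noncomputable section

open Set Filter Topology MeasureTheory
open scoped InnerProductSpace RealInnerProductSpace ENNReal NNReal ContDiff
open Literature.Analysis.FluidPDE

namespace Summit.NavierStokesRegularity.NavierStokesRegularity.Theorems

-- the problem directory repeats the summit name (`NavierStokesRegularity/NavierStokesRegularity`)
set_option linter.dupNamespace false

namespace DepletionLadder

/-- `log(T/(T−t)) → +∞` as `t ↑ T` (`T > 0`). [folklore] -/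
theorem tendsto_log_div_sub_atTop {T : ℝ} (hT : 0 < T) :
    Tendsto (fun t => Real.log (T / (T - t))) (𝓝[<] T) atTop := by
  have h1 : Tendsto (fun t => T - t) (𝓝[<] T) (𝓝[>] 0) := by
    refine tendsto_nhdsWithin_of_tendsto_nhds_of_eventually_within _ ?_ ?_
    · have : Tendsto (fun t => T - t) (𝓝 T) (𝓝 (T - T)) := (tendsto_const_nhds.sub tendsto_id)
      rw [sub_self] at this
      exact this.mono_left nhdsWithin_le_nhds
    · filter_upwards [self_mem_nhdsWithin] with t ht
      exact sub_pos.2 (mem_Iio.1 ht)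
  have h2 : Tendsto (fun t => (T - t)⁻¹) (𝓝[<] T) atTop := tendsto_inv_nhdsGT_zero.comp h1
  have h3 : Tendsto (fun t => T * (T - t)⁻¹) (𝓝[<] T) atTop := h2.const_mul_atTop hT
  have h4 : Tendsto (fun t => T / (T - t)) (𝓝[<] T) atTop :=
    h3.congr fun t => (div_eq_mul_inv T (T - t)).symm
  exact Real.tendsto_log_atTop.comp h4

/-- **Absorbing the additive constant.** If `0 ≤ a < a'` and `F t ≤ a·log(T/(T−t)) + B` on `[0,T)` (`T > 0`), then
eventually as `t ↑ T`, `F t ≤ a'·log(T/(T−t))`. [folklore] -/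
theorem eventually_le_of_logMean_bound {F : ℝ → ℝ} {T a a' B : ℝ} (hT : 0 < T) (haa' : a < a')
    (h : ∀ t ∈ Ico 0 T, F t ≤ a * Real.log (T / (T - t)) + B) :
    ∀ᶠ t in 𝓝[<] T, F t ≤ a' * Real.log (T / (T - t)) := by
  have hδ : 0 < a' - a := sub_pos.2 haa'
  filter_upwards [(tendsto_log_div_sub_atTop hT).eventually (eventually_ge_atTop (B / (a' - a))),
    Ioo_mem_nhdsLT hT] with t hLt ht
  have hB : B ≤ (a' - a) * Real.log (T / (T - t)) := by
    rw [div_le_iff₀ hδ] at hLt; linarith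
  have := h t ⟨ht.1.le, ht.2⟩
  nlinarith

/-- **Restoring the additive constant.** If `k : ℝ → [0,1]` is measurable, `T > 0`, `0 ≤ a`, and eventually as
`t ↑ T`, `∫_0^t k²/(T−τ) ≤ a·log(T/(T−t))`, then for some `B` the bound `∫_0^t k²/(T−τ) ≤ a·log(T/(T−t)) + B` holds
for ALL `t ∈ [0,T)` (before the eventual time the integral is below its value there). [folklore] -/
theorem logMean_bound_of_eventually {k : ℝ → ℝ} {T a : ℝ} (hkm : Measurable k) (hk01 : ∀ τ, 0 ≤ k τ ∧ k τ ≤ 1)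
    (hT : 0 < T) (ha : 0 ≤ a)
    (h : ∀ᶠ t in 𝓝[<] T, ∫ τ in (0 : ℝ)..t, k τ ^ 2 / (T - τ) ≤ a * Real.log (T / (T - t))) :
    ∃ B : ℝ, ∀ t ∈ Ico 0 T, ∫ τ in (0 : ℝ)..t, k τ ^ 2 / (T - τ) ≤ a * Real.log (T / (T - t)) + B := by
  obtain ⟨t₀, ht₀T, hsub⟩ := mem_nhdsLT_iff_exists_Ioo_subset.1 h
  set t₁ : ℝ := max t₀ 0 with ht₁
  have ht₁0 : 0 ≤ t₁ := le_max_right _ _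
  have ht₁T : t₁ < T := max_lt ht₀T hT
  set B : ℝ := ∫ τ in (0 : ℝ)..t₁, k τ ^ 2 / (T - τ) with hB
  have hB0 : 0 ≤ B :=
    intervalIntegral.integral_nonneg ht₁0 fun τ hτ => div_nonneg (sq_nonneg _) (by linarith [hτ.2])
  refine ⟨B, fun t ht => ?_⟩
  have hlog0 : 0 ≤ Real.log (T / (T - t)) :=
    Real.log_nonneg ((one_le_div (sub_pos.2 ht.2)).2 (by linarith [ht.1]))
  rcases le_or_gt t t₁ with h1 | h1
  · -- before `t₁`: monotonicity of the integral of a nonnegative function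
    have hadd : B = (∫ τ in (0 : ℝ)..t, k τ ^ 2 / (T - τ)) + ∫ τ in t..t₁, k τ ^ 2 / (T - τ) :=
      (intervalIntegral.integral_add_adjacent_intervals
        (intervalIntegrable_coeff_sq_div hkm hk01 ht.1 ht.2)
        (intervalIntegrable_coeff_sq_div hkm hk01 h1 ht₁T)).symm
    have hnn : 0 ≤ ∫ τ in t..t₁, k τ ^ 2 / (T - τ) :=
      intervalIntegral.integral_nonneg h1 fun τ hτ => div_nonneg (sq_nonneg _) (by linarith [hτ.2])
    have hmul : 0 ≤ a * Real.log (T / (T - t)) := mul_nonneg ha hlog0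
    linarith
  · -- after `t₁`: the eventual bound
    have ht' : t ∈ Ioo t₀ T := ⟨lt_of_le_of_lt (le_max_left _ _) h1, ht.2⟩
    have := hsub ht'
    simp only [mem_setOf_eq] at this
    linarith

end DepletionLadder

open DepletionLadder

/-- **THE CRUX AS EVENTUAL DOMINATION (no additive constant).** `NearExtremalTransience`
(stmt-NavierStokesRegularity-21883) holds iff there is `θ ∈ [0,1)` such that for every Type-I singular classical
Leray–Hopf rapidly-decaying-datum flow on `[0,T)` and every measurable minimal flow-wise coefficient `k₀ : ℝ → [0,1]`
on `[0,T)` (the stretching efficiency): eventually as `t ↑ T`, `∫_0^t k₀²/(T−τ) ≤ (θκ⋆)²·log(T/(T−t))`,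
`κ⋆ = sInf {universal depletion constants}`. (`→`: `nearExtremalTransience_iff_sharp_onsetZero` with `θ`, then
`eventually_le_of_logMean_bound` with `θ' = (1+θ)/2`; `←`: `logMean_bound_of_eventually`, then the onset-zero form.)
[folklore] -/
theorem nearExtremalTransience_iff_sharp_eventually :
    Summit.NavierStokesRegularity.NavierStokesRegularity.Theses.ExtremiserTransience.NearExtremalTransience ↔
    (∃ θ : ℝ, 0 ≤ θ ∧ θ < 1 ∧ ∀ (C ν T : ℝ), 0 < C → 0 < ν → 0 < T → ∀ (u : ℝ → EuclideanSpace ℝ (Fin 3) → EuclideanSpace ℝ (Fin 3)) (p : ℝ → EuclideanSpace ℝ (Fin 3) → ℝ), Literature.Analysis.FluidPDE.IsClassicalNSSolutionOn (Set.Ico 0 T) ν 0 u p → Literature.Analysis.FluidPDE.IsLerayHopfOn T ν 0 (u 0) u → Literature.Analysis.FluidPDE.HasRapidSpatialDecay (u 0) → (∀ᶠ t in 𝓝[<] T, ∀ x, Real.sqrt (T - t) * ‖u t x‖ ≤ C * Real.sqrt ν) → ¬ Literature.Analysis.FluidPDE.HasSmoothExtensionPast ν 0 u T → ∀ k₀ :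 ℝ → ℝ, Measurable k₀ → (∀ τ, 0 ≤ k₀ τ ∧ k₀ τ ≤ 1) → (∀ t ∈ Set.Ico 0 T, ∀ M : ℝ, (∀ x, ‖u t x‖ ≤ M) → |∫ x, ⟪Literature.Analysis.FluidPDE.curl (u t) x, fderiv ℝ (u t) x (Literature.Analysis.FluidPDE.curl (u t) x)⟫_ℝ| ≤ k₀ t * M * Real.sqrt (∫ x, ‖Literature.Analysis.FluidPDE.curl (u t) x‖ ^ 2) * Real.sqrt (∫ x, Literature.Analysis.FluidPDE.frobeniusNormSq (fderiv ℝ (Literature.Analysis.FluidPDE.curl (u t)) x))) → (∀ t ∈ Set.Ico 0 T, ∀ c : ℝ, 0 ≤ c → (∀ M : ℝ, (∀ x, ‖u t x‖ ≤ M) → |∫ x, ⟪Literature.Analysis.FluidPDE.curl (u t) x, fderiv ℝ (u t) x (Literature.Analysis.FluidPDE.curl (u t) x)⟫_ℝ| ≤ c * M * Real.sqrt (∫ x, ‖Literature.Analysis.FluidPDE.curl (u t) x‖ ^ 2) * Real.sqrt (∫ x, Literature.Analysis.FluidPDE.frobeniusNormSq (fderiv ℝ (Literature.Analysis.FluidPDE.curl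 (u t)) x))) → k₀ t ≤ c) → ∀ᶠ t in 𝓝[<] T, ∫ τ in (0 : ℝ)..t, k₀ τ ^ 2 / (T - τ) ≤ (θ * (sInf {κ : ℝ | (∀ (v : EuclideanSpace ℝ (Fin 3) → EuclideanSpace ℝ (Fin 3)) (M B : ℝ), ContDiff ℝ (⊤ : ℕ∞) v → Literature.Analysis.FluidPDE.VectorCalculus.IsDivFree v → (∀ x, ‖v x‖ ≤ M) → (∀ x, ‖fderiv ℝ v x‖ ≤ B) → (∫⁻ x, ‖iteratedFDeriv ℝ 0 v x‖ₑ ^ 2 < ⊤) → (∫⁻ x, ‖iteratedFDeriv ℝ 1 v x‖ₑ ^ 2 < ⊤) → (∫⁻ x, ‖iteratedFDeriv ℝ 2 v x‖ₑ ^ 2 < ⊤) → |∫ x, ⟪Literature.Analysis.FluidPDE.curl v x, fderiv ℝ v x (Literature.Analysis.FluidPDE.curl v x)⟫_ℝ| ≤ κ * M * Real.sqrt (∫ x, ‖Literature.Analysis.FluidPDE.curl v x‖ ^ 2) * Real.sqrt (∫ x, Literature.Analysis.FluidPDE.frobeniusNormSq (fderiv ℝ (Literature.Analysis.FluidPDE.curl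 v) x)))})) ^ 2 * Real.log (T / (T - t))) := by
  have hκpos : 0 < sInf {κ : ℝ | (∀ (v : EuclideanSpace ℝ (Fin 3) → EuclideanSpace ℝ (Fin 3)) (M B : ℝ), ContDiff ℝ (⊤ : ℕ∞) v → Literature.Analysis.FluidPDE.VectorCalculus.IsDivFree v → (∀ x, ‖v x‖ ≤ M) → (∀ x, ‖fderiv ℝ v x‖ ≤ B) → (∫⁻ x, ‖iteratedFDeriv ℝ 0 v x‖ₑ ^ 2 < ⊤) → (∫⁻ x, ‖iteratedFDeriv ℝ 1 v x‖ₑ ^ 2 < ⊤) → (∫⁻ x, ‖iteratedFDeriv ℝ 2 v x‖ₑ ^ 2 < ⊤) → |∫ x, ⟪Literature.Analysis.FluidPDE.curl v x, fderiv ℝ v x (Literature.Analysis.FluidPDE.curl v x)⟫_ℝ| ≤ κ * M * Real.sqrt (∫ x, ‖Literature.Analysis.FluidPDE.curl v x‖ ^ 2) * Real.sqrt (∫ x, Literature.Analysis.FluidPDE.frobeniusNormSq (fderiv ℝ (Literature.Analysis.FluidPDE.curl v) x)))} := lt_trans (by norm_num) sharpDepletion_gt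
  constructor
  · intro hNET
    obtain ⟨θ, hθ0, hθ1, H⟩ := nearExtremalTransience_iff_sharp_onsetZero.1 hNET
    refine ⟨(1 + θ) / 2, by linarith, by linarith, ?_⟩
    intro C ν T hC hν hT u p hsol hLH hdec hrate hext k₀ hk₀m hk₀01 hcl hmin
    obtain ⟨B, hB⟩ := H C ν T hC hν hT u p hsol hLH hdec hrate hext k₀ hk₀m hk₀01 hcl hmin
    have hlt : (θ * sInf {κ : ℝ | (∀ (v : EuclideanSpace ℝ (Fin 3) → EuclideanSpace ℝ (Fin 3)) (M B : ℝ), ContDiff ℝ (⊤ : ℕ∞) v → Literature.Analysis.FluidPDE.VectorCalculus.IsDivFree v → (∀ x, ‖v x‖ ≤ M) → (∀ x, ‖fderiv ℝ v x‖ ≤ B) → (∫⁻ x, ‖iteratedFDeriv ℝ 0 v x‖ₑ ^ 2 < ⊤) → (∫⁻ x, ‖iteratedFDeriv ℝ 1 v x‖ₑ ^ 2 < ⊤) → (∫⁻ x, ‖iteratedFDeriv ℝ 2 v x‖ₑ ^ 2 < ⊤) → |∫ x, ⟪Literature.Analysis.FluidPDE.curl v x, fderiv ℝ v x (Literature.Analysis.FluidPDE.curl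 v x)⟫_ℝ| ≤ κ * M * Real.sqrt (∫ x, ‖Literature.Analysis.FluidPDE.curl v x‖ ^ 2) * Real.sqrt (∫ x, Literature.Analysis.FluidPDE.frobeniusNormSq (fderiv ℝ (Literature.Analysis.FluidPDE.curl v) x)))}) ^ 2 < ((1 + θ) / 2 * sInf {κ : ℝ | (∀ (v : EuclideanSpace ℝ (Fin 3) → EuclideanSpace ℝ (Fin 3)) (M B : ℝ), ContDiff ℝ (⊤ : ℕ∞) v → Literature.Analysis.FluidPDE.VectorCalculus.IsDivFree v → (∀ x, ‖v x‖ ≤ M) → (∀ x, ‖fderiv ℝ v x‖ ≤ B) → (∫⁻ x, ‖iteratedFDeriv ℝ 0 v x‖ₑ ^ 2 < ⊤) → (∫⁻ x, ‖iteratedFDeriv ℝ 1 v x‖ₑ ^ 2 < ⊤) → (∫⁻ x, ‖iteratedFDeriv ℝ 2 v x‖ₑ ^ 2 < ⊤) → |∫ x, ⟪Literature.Analysis.FluidPDE.curl v x, fderiv ℝ v x (Literature.Analysis.FluidPDE.curl v x)⟫_ℝ| ≤ κ * M * Real.sqrt (∫ x, ‖Literature.Analysis.FluidPDE.curl v x‖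 ^ 2) * Real.sqrt (∫ x, Literature.Analysis.FluidPDE.frobeniusNormSq (fderiv ℝ (Literature.Analysis.FluidPDE.curl v) x)))}) ^ 2 := by
      have h1 : θ * sInf {κ : ℝ | (∀ (v : EuclideanSpace ℝ (Fin 3) → EuclideanSpace ℝ (Fin 3)) (M B : ℝ), ContDiff ℝ (⊤ : ℕ∞) v → Literature.Analysis.FluidPDE.VectorCalculus.IsDivFree v → (∀ x, ‖v x‖ ≤ M) → (∀ x, ‖fderiv ℝ v x‖ ≤ B) → (∫⁻ x, ‖iteratedFDeriv ℝ 0 v x‖ₑ ^ 2 < ⊤) → (∫⁻ x, ‖iteratedFDeriv ℝ 1 v x‖ₑ ^ 2 < ⊤) → (∫⁻ x, ‖iteratedFDeriv ℝ 2 v x‖ₑ ^ 2 < ⊤) → |∫ x, ⟪Literature.Analysis.FluidPDE.curl v x, fderiv ℝ v x (Literature.Analysis.FluidPDE.curl v x)⟫_ℝ| ≤ κ * M * Real.sqrt (∫ x, ‖Literature.Analysis.FluidPDE.curl v x‖ ^ 2) * Real.sqrt (∫ x, Literature.Analysis.FluidPDE.frobeniusNormSq (fderiv ℝ (Literature.Analysis.FluidPDE.curl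 v) x)))} < (1 + θ) / 2 * sInf {κ : ℝ | (∀ (v : EuclideanSpace ℝ (Fin 3) → EuclideanSpace ℝ (Fin 3)) (M B : ℝ), ContDiff ℝ (⊤ : ℕ∞) v → Literature.Analysis.FluidPDE.VectorCalculus.IsDivFree v → (∀ x, ‖v x‖ ≤ M) → (∀ x, ‖fderiv ℝ v x‖ ≤ B) → (∫⁻ x, ‖iteratedFDeriv ℝ 0 v x‖ₑ ^ 2 < ⊤) → (∫⁻ x, ‖iteratedFDeriv ℝ 1 v x‖ₑ ^ 2 < ⊤) → (∫⁻ x, ‖iteratedFDeriv ℝ 2 v x‖ₑ ^ 2 < ⊤) → |∫ x, ⟪Literature.Analysis.FluidPDE.curl v x, fderiv ℝ v x (Literature.Analysis.FluidPDE.curl v x)⟫_ℝ| ≤ κ * M * Real.sqrt (∫ x, ‖Literature.Analysis.FluidPDE.curl v x‖ ^ 2) * Real.sqrt (∫ x, Literature.Analysis.FluidPDE.frobeniusNormSq (fderiv ℝ (Literature.Analysis.FluidPDE.curl v) x)))} := mul_lt_mul_of_pos_right (by linarith) hκpos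
      have h0 : 0 ≤ θ * sInf {κ : ℝ | (∀ (v : EuclideanSpace ℝ (Fin 3) → EuclideanSpace ℝ (Fin 3)) (M B : ℝ), ContDiff ℝ (⊤ : ℕ∞) v → Literature.Analysis.FluidPDE.VectorCalculus.IsDivFree v → (∀ x, ‖v x‖ ≤ M) → (∀ x, ‖fderiv ℝ v x‖ ≤ B) → (∫⁻ x, ‖iteratedFDeriv ℝ 0 v x‖ₑ ^ 2 < ⊤) → (∫⁻ x, ‖iteratedFDeriv ℝ 1 v x‖ₑ ^ 2 < ⊤) → (∫⁻ x, ‖iteratedFDeriv ℝ 2 v x‖ₑ ^ 2 < ⊤) → |∫ x, ⟪Literature.Analysis.FluidPDE.curl v x, fderiv ℝ v x (Literature.Analysis.FluidPDE.curl v x)⟫_ℝ| ≤ κ * M * Real.sqrt (∫ x, ‖Literature.Analysis.FluidPDE.curl v x‖ ^ 2) * Real.sqrt (∫ x, Literature.Analysis.FluidPDE.frobeniusNormSq (fderiv ℝ (Literature.Analysis.FluidPDE.curl v) x)))} := mul_nonneg hθ0 hκpos.le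
      exact pow_lt_pow_left₀ h1 h0 two_ne_zero
    exact eventually_le_of_logMean_bound hT hlt hB
  · rintro ⟨θ, hθ0, hθ1, H⟩
    refine nearExtremalTransience_iff_sharp_onsetZero.2 ⟨θ, hθ0, hθ1, ?_⟩
    intro C ν T hC hν hT u p hsol hLH hdec hrate hext k₀ hk₀m hk₀01 hcl hmin
    exact logMean_bound_of_eventually hk₀m hk₀01 hT (sq_nonneg _)
      (H C ν T hC hν hT u p hsol hLH hdec hrate hext k₀ hk₀m hk₀01 hcl hmin)

end Summit.NavierStokesRegularity.NavierStokesRegularity.Theorems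

end
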